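import Literature.NumberTheory.Transcendental.KZHomotopyMoves
import Literature.NumberTheory.Transcendental.KZProductIdeal

/-!
# Green's theorem on a region sliced both ways, with null exceptional fibres, inside the KZ calculus

Support file (prover-owned, `--supports stmt-KontsevichZagierPeriods-5277`, item `ManinStokes` of route
HeckeMultiplicityOne; stated in general and reusable by any route). Engine of the per-tile Cauchy step of
Manin's three-term relation: Cauchy's theorem for a holomorphic function on the unit disc with finitely many
integrable BOUNDARY singularities, written as a chain of Kontsevich–Zagier moves — rule (3) along the last
coordinate on a vertical band, the coordinate swap (rule (2), `KZ.of_sub_of_reindex_mem_relations`), rule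
(3) on the horizontal band, integrand additivity — exactly as in
`Theorems/IsogenyCertificatesJLPairIdentityOneGreenOnLens.lean` (`greenOnLens`), except that the two bands
need not be the same set: the vertical band `Ω = band τ a b` and the horizontal band `Ω' = band τ' c d`
(in swapped coordinates) only have to contain a common `ℚ`-semialgebraic set `W` (resp. its swap) up to
null sets. This is what boundary singularities require: over the finitely many base points whose fibre
ends at a singular boundary point the fibrewise primitive is not continuous on the closed fibre, so these
base points are removed from `τ` (vertical slices) and from `τ'` (horizontal slices) — different null
sets of the region.

`green_punctured`: with `P` a fibrewise primitive of `gv` along the vertical slices of `Ω`, `Q` one of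
`gh` along the horizontal slices of `Ω'`, `gv ∘ swap = gh` on the swap `W'` of `W`, `Ω ∖ W` and
`Ω' ∖ W'` null: for any edge representations `rT, rB` over `τ` (integrands `P(x, b x)`, `P(x, a x)`)
and `rR, rL` over `τ'` (integrands `Q(y, d y)`, `Q(y, c y)`),
`[rT] − [rB] − ([rR] − [rL]) ∈ KZ.relations`.

References: M. Kontsevich, D. Zagier, *Periods* (2001), §1.2 rules (1)–(3). No definitions, no named
facts; everything is proved.
-/

noncomputable section

open Set MeasureTheory
open Literature.NumberTheory.Transcendental Literature.ModelTheory.ExponentialFields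

namespace Summit.KontsevichZagierPeriods.HeckeMultiplicityOne.ManinStokes

/-- **Green's theorem inside the KZ calculus on a region sliced both ways, up to null sets.** See the
module docstring. Hypotheses: the vertical band `Ω = band τ a b` with a `ℚ`-semialgebraic integrable
`gv` and a fibrewise primitive `P` (continuous on each closed vertical slice, derivative `gv` on the open
slice); the horizontal band `Ω' = band τ' c d` (coordinates swapped) with `gh`, `Q` likewise; a
`ℚ`-semialgebraic `W' ⊆ swap⁻¹ Ω ∩ Ω'` on which `gv ∘ swap = gh`, with `swap⁻¹ Ω ∖ W'` and `Ω' ∖ W'`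
Lebesgue-null. Conclusion: `[rT] − [rB] − ([rR] − [rL]) ∈ KZ.relations` for the four edge
representations. [cite: KontsevichZagierPeriods2001, §1.2 rule (3)] -/
theorem green_punctured (τ τ' : Set (Fin 1 → ℝ)) (a b c d : (Fin 1 → ℝ) → ℝ)
    (ha : IsSemialgebraicFunOn ℚ τ a) (hb : IsSemialgebraicFunOn ℚ τ b) (hab : ∀ x ∈ τ, a x ≤ b x)
    (hc : IsSemialgebraicFunOn ℚ τ' c) (hd : IsSemialgebraicFunOn ℚ τ' d)
    (hcd : ∀ y ∈ τ', c y ≤ d y)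
    (W' : Set (Fin 2 → ℝ)) (hW' : IsSemialgebraic ℚ W')
    (hW'v : W' ⊆ {w | (fun i => w (Equiv.swap (0 : Fin 2) 1 i)) ∈ KZlog.band τ a b})
    (hW'h : W' ⊆ KZlog.band τ' c d)
    (hvolv : volume ({w : Fin 2 → ℝ | (fun i => w (Equiv.swap (0 : Fin 2) 1 i)) ∈ KZlog.band τ a b} \ W') = 0)
    (hvolh : volume (KZlog.band τ' c d \ W') = 0)
    (gv gh P Q : (Fin 2 → ℝ) → ℝ)
    (hgv : IsSemialgebraicFunOn ℚ (KZlog.band τ a b) gv) (hgvi : IntegrableOn gv (KZlog.band τ a b))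
    (hgh : IsSemialgebraicFunOn ℚ (KZlog.band τ' c d) gh) (hghi : IntegrableOn gh (KZlog.band τ' c d))
    (hagree : ∀ w ∈ W', gv (fun i => w (Equiv.swap (0 : Fin 2) 1 i)) = gh w)
    (hP : IsSemialgebraicFunOn ℚ (KZlog.band τ a b) P)
    (hPc : ∀ x ∈ τ, ContinuousOn (fun t : ℝ => P (Fin.snoc x t)) (Icc (a x) (b x)))
    (hPd : ∀ x ∈ τ, ∀ t ∈ Ioo (a x) (b x),
      HasDerivAt (fun s : ℝ => P (Fin.snoc x s)) (gv (Fin.snoc x t)) t)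
    (hQ : IsSemialgebraicFunOn ℚ (KZlog.band τ' c d) Q)
    (hQc : ∀ y ∈ τ', ContinuousOn (fun s : ℝ => Q (Fin.snoc y s)) (Icc (c y) (d y)))
    (hQd : ∀ y ∈ τ', ∀ s ∈ Ioo (c y) (d y),
      HasDerivAt (fun s' : ℝ => Q (Fin.snoc y s')) (gh (Fin.snoc y s)) s)
    (rT rB rR rL : KZ.IntegralRep 1)
    (hT : rT.domain = τ) (hB : rB.domain = τ) (hR : rR.domain = τ') (hL : rL.domain = τ')
    (hTi : ∀ x ∈ τ, rT.integrand x = P (Fin.snoc x (b x)))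
    (hBi : ∀ x ∈ τ, rB.integrand x = P (Fin.snoc x (a x)))
    (hRi : ∀ y ∈ τ', rR.integrand y = Q (Fin.snoc y (d y)))
    (hLi : ∀ y ∈ τ', rL.integrand y = Q (Fin.snoc y (c y))) :
    KZ.of rT - KZ.of rB - (KZ.of rR - KZ.of rL) ∈ KZ.relations := by
  have hτ : IsSemialgebraic ℚ τ := hT ▸ rT.isSemialgebraic_domain
  have hτ' : IsSemialgebraic ℚ τ' := hR ▸ rR.isSemialgebraic_domain
  -- the vertical band representation `[Ω, gv]` and its Newton–Leibniz move
  let R : KZ.IntegralRep 2 := ⟨KZlog.band τ a b, gv, KZlog.isSemialgebraic_band ha hb, hgv, hgvi⟩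
  have hTsa : IsSemialgebraicFunOn ℚ τ rT.integrand := hT ▸ rT.isSemialgebraicFunOn_integrand
  have hBsa : IsSemialgebraicFunOn ℚ τ rB.integrand := hB ▸ rB.isSemialgebraicFunOn_integrand
  have hTint : IntegrableOn rT.integrand τ := hT ▸ rT.integrableOn
  have hBint : IntegrableOn rB.integrand τ := hB ▸ rB.integrableOn
  let dv : KZ.IntegralRep 1 := ⟨τ, fun x => rT.integrand x - rB.integrand x, hτ,
    IsSemialgebraicFunOn.sub_holds hTsa hBsa, hTint.sub hBint⟩
  have hNLv : KZ.of R - KZ.of dv ∈ KZ.relations := by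
    refine KZ.newtonLeibnizRel_subset_relations ⟨1, R, dv, a, b, P, hP, ha, hb, hab, rfl, hPc, hPd,
      ?_, rfl⟩
    intro x hx
    show rT.integrand x - rB.integrand x = P (Fin.snoc x (b x)) - P (Fin.snoc x (a x))
    rw [hTi x hx, hBi x hx]
  have hAv : KZ.of dv - KZ.of rT - KZ.of rB.neg ∈ KZ.relations := by
    refine KZ.integrandAddRel_subset_relations ⟨1, dv, rT, rB.neg, hT, ?_, fun x _ => ?_, rfl⟩
    · rw [KZ.IntegralRep.domain_neg, hB]
    · show rT.integrand x - rB.integrand x = (rT.integrand + (rB.neg).integrand) x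
      simp [KZ.IntegralRep.integrand_neg, sub_eq_add_neg]
  have hNb : KZ.of rB + KZ.of rB.neg ∈ KZ.relations :=
    KZ.levelRel_le_relations (KZ.of_add_of_neg_mem_levelRel rB)
  -- the horizontal band representation `[Ω', gh]` and its Newton–Leibniz move
  let Rh : KZ.IntegralRep 2 := ⟨KZlog.band τ' c d, gh, KZlog.isSemialgebraic_band hc hd, hgh, hghi⟩
  have hRsa : IsSemialgebraicFunOn ℚ τ' rR.integrand := hR ▸ rR.isSemialgebraicFunOn_integrand
  have hLsa : IsSemialgebraicFunOn ℚ τ' rL.integrand := hL ▸ rL.isSemialgebraicFunOn_integrand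
  have hRint : IntegrableOn rR.integrand τ' := hR ▸ rR.integrableOn
  have hLint : IntegrableOn rL.integrand τ' := hL ▸ rL.integrableOn
  let dh : KZ.IntegralRep 1 := ⟨τ', fun y => rR.integrand y - rL.integrand y, hτ',
    IsSemialgebraicFunOn.sub_holds hRsa hLsa, hRint.sub hLint⟩
  have hNLh : KZ.of Rh - KZ.of dh ∈ KZ.relations := by
    refine KZ.newtonLeibnizRel_subset_relations ⟨1, Rh, dh, c, d, Q, hQ, hc, hd, hcd, rfl, hQc, hQd,
      ?_, rfl⟩
    intro y hy
    show rR.integrand y - rL.integrand y = Q (Fin.snoc y (d y)) - Q (Fin.snoc y (c y))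
    rw [hRi y hy, hLi y hy]
  have hAh : KZ.of dh - KZ.of rR - KZ.of rL.neg ∈ KZ.relations := by
    refine KZ.integrandAddRel_subset_relations ⟨1, dh, rR, rL.neg, hR, ?_, fun y _ => ?_, rfl⟩
    · rw [KZ.IntegralRep.domain_neg, hL]
    · show rR.integrand y - rL.integrand y = (rR.integrand + (rL.neg).integrand) y
      simp [KZ.IntegralRep.integrand_neg, sub_eq_add_neg]
  have hNl : KZ.of rL + KZ.of rL.neg ∈ KZ.relations :=
    KZ.levelRel_le_relations (KZ.of_add_of_neg_mem_levelRel rL)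
  -- the swap (rule 2) and the two restrictions to the common set `W'`
  have hS := KZ.of_sub_of_reindex_mem_relations R (Equiv.swap (0 : Fin 2) 1)
  have hRv_res := KZ.IntegralRep.of_sub_of_restrict_mem_relations
    (R.reindex (Equiv.swap (0 : Fin 2) 1)) hW' hW'v hvolv
  have hRh_res := KZ.IntegralRep.of_sub_of_restrict_mem_relations Rh hW' hW'h hvolh
  have hres : KZ.of ((R.reindex (Equiv.swap (0 : Fin 2) 1)).restrict W' hW' hW'v) -
      KZ.of (Rh.restrict W' hW' hW'h) ∈ KZ.relations :=
    KZ.of_sub_of_mem_relations_of_eqOn rfl fun w hw => hagree w hw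
  -- bookkeeping: target = hNLv + hAv + hNb − (hS + hRv_res − hRh_res − hres) … assembled by `abel`
  have key := KZ.relations.sub_mem (KZ.relations.sub_mem (KZ.relations.sub_mem
    (KZ.relations.add_mem (KZ.relations.add_mem (KZ.relations.add_mem
      (KZ.relations.sub_mem (KZ.relations.add_mem (KZ.relations.add_mem hS hRv_res) hres) hRh_res)
      hNLh) hAh) hNl) hNLv) hAv) hNb
  convert key using 1
  abel

end Summit.KontsevichZagierPeriods.HeckeMultiplicityOne.ManinStokes
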